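import Literature.Analysis.FunctionSpaces.LiebWuIntegralsProofs
import Literature.Analysis.FunctionSpaces.BesselJWeberSchafheitlin
import Literature.Analysis.FunctionSpaces.BesselJWeber
import Literature.Analysis.SpecialFunctions.TanhPartialFractions
import HarnessLib

/-!
# Discharged fact: the Lieb–Wu charge gap of the half-filled Hubbard chain is positive for `U > 0`

`Literature.Analysis.FunctionSpaces.LiebWuIntegrals` records as a named fact
(`Literature.Hubbard.liebWuChargeGap_pos : Prop`) that the Lieb–Wu charge gap
`Δ(U) = μ₊ - μ₋ = U - 4 + 8 ∫₀^∞ J₁(ω) / (ω (1 + e^{ωU/2})) dω` (`Literature.Analysis.FunctionSpaces.liebWuChargeGap`) of the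
half-filled one-dimensional Hubbard chain is strictly positive for every `U > 0`: the chain is a Mott
insulator for all `U > 0`, there is no Mott transition (Lieb–Wu, *Absence of Mott transition in an
exact solution of the short-range, one-band model in one dimension*, PRL 20 (1968) 1445, discussion
after eq. (22); details in Lieb–Wu, *The one-dimensional Hubbard model: a reminiscence*, Physica A
321 (2003) 1–27 = arXiv:cond-mat/0207529, §7 "Absence of a Mott transition": `μ₊ + μ₋ = U`,
`μ₋(U) = 2 - 4 ∫₀^∞ J₁(ω)/(ω [1 + exp(ωU/2)]) dω` (the boxed formula of §7), and `μ₋ < U/2` for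
all `U > 0`).
This file proves it: `Literature.Analysis.FunctionSpaces.liebWuChargeGap_pos_holds`.

## Proof

Lieb–Wu show `μ₋ < U/2` from `μ₋(0) = 0`, `μ₋'(0) = 1/2` and the concavity
`μ₋''(U) = -(32/U³) ∫₁^∞ y² (y²-1)^{-3/2} / sinh(2πy/U) dy < 0`, obtained from the alternating series
`μ₋ = 2 - 4 ∑ (-1)ⁿ [√(1 + n²U²/4) - nU/2]` by a contour-integral (residue) representation. We give a
real-variable proof with the same structure "expand the Fermi factor, integrate term-wise", but using
the absolutely convergent partial-fraction expansion instead of the alternating geometric one.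
Write `a = U/2`, `σ(x) = 1/(1 + eˣ)`, `I(U) = ∫₀^∞ (J₁(ω)/ω) σ(aω) dω`, so `Δ(U) = U - 4 + 8 I(U)`.

1. (`Literature.Analysis.SpecialFunctions.hasSum_one_div_one_add_exp`, from Mathlib's Mittag-Leffler expansion of `cot`)
   `σ(x) = 1/2 - ∑_{k ≥ 0} 2x / (x² + (2k+1)²π²)`, all terms of the sum being `≥ 0` for `x > 0`;
   hence on `(0, ∞)`
   `(J₁(ω)/ω) σ(aω) = J₁(ω)/(2ω) - ∑_k F_k(ω)`, `F_k(ω) = J₁(ω) · 2a/((aω)² + (2k+1)²π²)`,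
   with `∑_k |F_k(ω)| ≤ |J₁(ω)/ω| / 2`, an integrable function (`Literature.Analysis.FunctionSpaces.integrableOn_besselJ_one_div`).
2. Term-wise integration (`MeasureTheory.integral_tsum_of_summable_integral_norm`) and
   `∫₀^∞ J₁(ω)/ω dω = 1` (`Literature.Analysis.FunctionSpaces.integral_Ioi_besselJ_one_div`) give
   `I(U) = 1/2 - ∑_k ∫₀^∞ F_k = 1/2 - (2/a) ∑_k G(c_k)`, where `G(c) = ∫₀^∞ J₁(ω)/(ω² + c²) dω` and
   `c_k = (2k+1)π/a`.
3. By the Weber–Hankel exponential integral `∫₀^∞ e^{-uω²} J₁(ω) dω = 1 - e^{-1/(4u)}` and the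
   subordination `1/(ω²+c²) = ∫₀^∞ e^{-(ω²+c²)u} du`,
   `c² G(c) = 1 - c² ∫₀^∞ e^{-c²u - 1/(4u)} du < 1` for `c ≠ 0`
   (`Literature.Analysis.FunctionSpaces.sq_mul_integral_besselJ_one_div_sq_add_sq_lt_one`).
4. Hence `(2/a) ∑_k G(c_k) < (2/a) ∑_k 1/c_k² = (2a/π²) ∑_k 1/(2k+1)² = (2a/π²)(π²/8) = a/4`
   (`Literature.Analysis.SpecialFunctions.hasSum_one_div_odd_sq`, strict by `hasSum_lt`), i.e. `I(U) > 1/2 - U/8` and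
   `Δ(U) = U - 4 + 8 I(U) > 0`.

## References

* E. H. Lieb, F. Y. Wu, Phys. Rev. Lett. 20 (1968) 1445–1448, eq. (22) and the discussion following
  it (`μ₊ - μ₋ > 0` for `U > 0`: no Mott transition).
* E. H. Lieb, F. Y. Wu, Physica A 321 (2003) 1–27, arXiv:cond-mat/0207529, §7, p. 15 of the arXiv
  version: `μ₊ + μ₋ = U`, the boxed formula for `μ₋(U)`, `μ₋(0) = 0`, `μ₋'(0) = 1/2`, `μ₋'' < 0`.
* G. E. Andrews, R. Askey, R. Roy, *Special Functions* (1999), (1.2.5) (partial fractions of `cot`),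
  Theorem 4.11.7 (4.11.23) (the Weber–Hankel exponential integral).
-/

noncomputable section

open Set MeasureTheory Real

namespace Literature.Analysis.FunctionSpaces

section Hubbard

/-- **Discharge of `Literature.Analysis.FunctionSpaces.liebWuChargeGap_pos`** (Mott insulator for all `U > 0`): the
Lieb–Wu charge gap `Δ(U) = U - 4 + 8 ∫₀^∞ J₁(ω) / (ω (1 + e^{ωU/2})) dω` of the half-filled
Hubbard chain is strictly positive for every `U > 0` (Lieb–Wu, PRL 20 (1968) 1445, discussion after
eq. (22); Physica A 321 (2003) 1, §7 "Absence of a Mott transition", where `μ₊ - μ₋ > 0` for `U > 0`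
is derived from `μ₊ + μ₋ = U` and the concavity of
`μ₋(U) = 2 - 4 ∫₀^∞ J₁(ω)/(ω(1 + e^{ωU/2})) dω`). The proof given here expands the Fermi factor in
partial fractions and bounds each term by the Weber–Hankel exponential integral (see the module
docstring):
`∫₀^∞ J₁(ω)/(ω(1 + e^{ωU/2})) dω = 1/2 - (4/U) ∑_{k ≥ 0} ∫₀^∞ J₁(ω)/(ω² + c_k²) dω > 1/2 - U/8`,
`c_k = (2k+1) 2π/U`. [cite: LiebWuPRL1968, discussion after eq. (22)] -/
theorem liebWuChargeGap_pos_holds : liebWuChargeGap_pos := by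
  intro U hU
  show 0 < U - 4 + 8 * ∫ ω in Ioi (0 : ℝ), liebWuChargeGapIntegrand U ω
  -- `a = U/2`; the terms `F k ω = J₁(ω) · 2a/((aω)² + (2k+1)²π²)` of the expansion
  set a : ℝ := U / 2 with ha
  have ha0 : 0 < a := by positivity
  set F : ℕ → ℝ → ℝ := fun k ω =>
    besselJ 1 ω * (2 * a / ((a * ω) ^ 2 + (2 * k + 1) ^ 2 * π ^ 2)) with hF
  have hD : ∀ (k : ℕ) (ω : ℝ), 0 < (a * ω) ^ 2 + (2 * k + 1) ^ 2 * π ^ 2 := fun k ω => by positivity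
  -- the scalar expansion of the Fermi factor at `aω`, `ω > 0`: non-negative terms, sum `≤ 1/2`
  have hfermi : ∀ ω : ℝ, HasSum (fun k : ℕ => 2 * (a * ω) / ((a * ω) ^ 2 + (2 * k + 1) ^ 2 * π ^ 2))
      (1 / 2 - 1 / (1 + Real.exp (a * ω))) := fun ω => SpecialFunctions.hasSum_one_div_one_add_exp (a * ω)
  have hfermi_le : ∀ ω : ℝ, 0 < ω → ∀ s : Finset ℕ,
      ∑ k ∈ s, 2 * (a * ω) / ((a * ω) ^ 2 + (2 * k + 1) ^ 2 * π ^ 2) ≤ 1 / 2 := by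
    intro ω hω s
    refine (sum_le_hasSum s (fun k _ => (div_pos (by positivity) (hD k ω)).le) (hfermi ω)).trans ?_
    have : 0 < 1 / (1 + Real.exp (a * ω)) := by positivity
    linarith
  -- (1) pointwise expansion of the integrand on `(0, ∞)`
  have hexp : ∀ ω ∈ Ioi (0 : ℝ), HasSum (fun k => F k ω)
      (1 / 2 * (besselJ 1 ω / ω) - liebWuChargeGapIntegrand U ω) := by
    intro ω hω
    have hω : (0 : ℝ) < ω := hω
    have he : 0 < 1 + Real.exp (a * ω) := by positivity
    have h := (hfermi ω).mul_left (besselJ 1 ω / ω)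
    have hval : besselJ 1 ω / ω * (1 / 2 - 1 / (1 + Real.exp (a * ω))) =
        1 / 2 * (besselJ 1 ω / ω) - liebWuChargeGapIntegrand U ω := by
      simp only [liebWuChargeGapIntegrand]
      rw [show ω * U / 2 = a * ω by rw [ha]; ring]
      field_simp
    rw [hval] at h
    refine h.congr_fun fun k => ?_
    simp only [hF]
    field_simp
  -- (2) the dominating function `‖J₁(ω)/ω‖ / 2`
  have hB : IntegrableOn (fun ω : ℝ => ‖besselJ 1 ω / ω‖ / 2) (Ioi 0) :=
    integrableOn_besselJ_one_div.norm.div_const 2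
  have hFcont : ∀ k, Continuous (F k) := fun k =>
    (continuous_besselJ_holds 1).mul ((continuous_const).div (by fun_prop) fun ω => (hD k ω).ne')
  have hFabs : ∀ (k : ℕ) (ω : ℝ), 0 < ω →
      ‖F k ω‖ = ‖besselJ 1 ω / ω‖ * (2 * (a * ω) / ((a * ω) ^ 2 + (2 * k + 1) ^ 2 * π ^ 2)) := by
    intro k ω hω
    have ht : 0 < 2 * a / ((a * ω) ^ 2 + (2 * k + 1) ^ 2 * π ^ 2) := div_pos (by positivity) (hD k ω)
    simp only [hF]
    rw [Real.norm_eq_abs, Real.norm_eq_abs, abs_mul, abs_of_pos ht, abs_div, abs_of_pos hω]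
    field_simp
  have hFsum_le : ∀ (s : Finset ℕ) (ω : ℝ), 0 < ω → ∑ k ∈ s, ‖F k ω‖ ≤ ‖besselJ 1 ω / ω‖ / 2 := by
    intro s ω hω
    simp_rw [hFabs _ ω hω, ← Finset.mul_sum]
    calc ‖besselJ 1 ω / ω‖ * ∑ k ∈ s, 2 * (a * ω) / ((a * ω) ^ 2 + (2 * k + 1) ^ 2 * π ^ 2)
        ≤ ‖besselJ 1 ω / ω‖ * (1 / 2) :=
          mul_le_mul_of_nonneg_left (hfermi_le ω hω s) (norm_nonneg _)
      _ = ‖besselJ 1 ω / ω‖ / 2 := by ring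
  have hint : ∀ k, Integrable (F k) (volume.restrict (Ioi 0)) := by
    intro k
    refine Integrable.mono' hB (hFcont k).aestronglyMeasurable ?_
    refine ae_restrict_of_forall_mem measurableSet_Ioi fun ω (hω : 0 < ω) => ?_
    simpa using hFsum_le {k} ω hω
  -- (3) summability of `k ↦ ∫ ‖F k‖`: the partial sums are bounded by `∫ ‖J₁/ω‖ / 2`
  have hsum : Summable fun k => ∫ ω in Ioi (0 : ℝ), ‖F k ω‖ := by
    refine summable_of_sum_range_le (c := ∫ ω in Ioi (0 : ℝ), ‖besselJ 1 ω / ω‖ / 2)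
      (fun k => integral_nonneg fun ω => norm_nonneg _) fun N => ?_
    rw [← integral_finsetSum _ fun k _ => (hint k).norm]
    exact setIntegral_mono_on (integrable_finsetSum _ fun k _ => (hint k).norm) hB
      measurableSet_Ioi fun ω (hω : 0 < ω) => hFsum_le _ ω hω
  -- (4) term-wise integration
  have hswap := integral_tsum_of_summable_integral_norm hint hsum
  have hrhs : ∫ ω in Ioi (0 : ℝ), ∑' k, F k ω =
      1 / 2 - ∫ ω in Ioi (0 : ℝ), liebWuChargeGapIntegrand U ω := by
    rw [setIntegral_congr_fun measurableSet_Ioi fun ω hω => (hexp ω hω).tsum_eq,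
      integral_sub (integrableOn_besselJ_one_div.const_mul _)
        (integrableOn_liebWuChargeGap_integrand_holds hU.le),
      integral_const_mul, integral_Ioi_besselJ_one_div, mul_one]
  -- (5) each term is `(2/a) G(c_k) < 2a/((2k+1)²π²)`, `c_k = (2k+1)π/a`
  have hterm : ∀ k : ℕ, ∫ ω in Ioi (0 : ℝ), F k ω < 2 * a / ((2 * k + 1) ^ 2 * π ^ 2) := by
    intro k
    set c : ℝ := (2 * k + 1) * π / a with hc
    have hc0 : 0 < c := by positivity
    have hFc : ∀ ω : ℝ, F k ω = 2 / a * (besselJ 1 ω / (ω ^ 2 + c ^ 2)) := by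
      intro ω
      simp only [hF, hc]
      have hωc : 0 < ω ^ 2 + ((2 * k + 1) * π / a) ^ 2 := by positivity
      field_simp
    simp_rw [hFc]
    rw [integral_const_mul]
    have hG := sq_mul_integral_besselJ_one_div_sq_add_sq_lt_one hc0.ne'
    have hG' : ∫ ω in Ioi (0 : ℝ), besselJ 1 ω / (ω ^ 2 + c ^ 2) < 1 / c ^ 2 := by
      rw [lt_div_iff₀ (by positivity), mul_comm]
      exact hG
    calc 2 / a * ∫ ω in Ioi (0 : ℝ), besselJ 1 ω / (ω ^ 2 + c ^ 2) < 2 / a * (1 / c ^ 2) :=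
          mul_lt_mul_of_pos_left hG' (by positivity)
      _ = 2 * a / ((2 * k + 1) ^ 2 * π ^ 2) := by
          rw [hc]
          field_simp
  -- (6) the comparison series sums to `a/4`
  have hg : HasSum (fun k : ℕ => 2 * a / ((2 * k + 1) ^ 2 * π ^ 2)) (a / 4) := by
    have h := SpecialFunctions.hasSum_one_div_odd_sq.mul_left (2 * a / π ^ 2)
    have hv : 2 * a / π ^ 2 * (π ^ 2 / 8) = a / 4 := by
      field_simp
      ring
    rw [hv] at h
    refine h.congr_fun fun k => ?_
    field_simp
  have hf : HasSum (fun k : ℕ => ∫ ω in Ioi (0 : ℝ), F k ω) (∑' k, ∫ ω in Ioi (0 : ℝ), F k ω) :=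
    (hsum.of_norm_bounded fun k => norm_integral_le_integral_norm _).hasSum
  have hlt : ∑' k, ∫ ω in Ioi (0 : ℝ), F k ω < a / 4 :=
    hasSum_lt (fun k => (hterm k).le) (hterm 0) hf hg
  -- (7) conclusion
  have hI : ∫ ω in Ioi (0 : ℝ), liebWuChargeGapIntegrand U ω =
      1 / 2 - ∑' k, ∫ ω in Ioi (0 : ℝ), F k ω := by
    rw [hswap, hrhs]
    ring
  rw [hI, ha] at *
  nlinarith [hlt]

end Hubbard

end Literature.Analysis.FunctionSpaces
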